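import Summits.AtomisticToContinuum.HydrodynamicLimit.Theorems.CollisionIsometryCLTCollisionalTransferLocalityDefsB
import Summits.AtomisticToContinuum.HydrodynamicLimit.Theses.GermanoSplitLES
import Literature.MathematicalPhysics.KineticTheory.HardSphereEulerSolutionGluing
import Literature.Analysis.FunctionSpaces.TorusSpaceTime
import Literature.Analysis.FluidPDE.ReleaseLogBoundDatum
import Literature.Analysis.FluidPDE.HardSpherePhaseSpaceProofs
import HarnessLib

/-!
# [D] `DiluteAt` from the registered item `GermanoSplitLES.KineticRangeControl`
(line `hemisphere-affine-slaving`, crux `CollisionalTransferLocality`, stmt-AtomisticToContinuum-9518)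

Helper file (`--supports stmt-AtomisticToContinuum-9518`) of the line lead (gen 1, seat c3). The line's open stub [D]
`stub_diluteBlocks` asks for the DILUTE BLOCK CEILING: for nice profiles `∃ ηbar ∀ 0 < η₁ ≤ ηbar ∃ σ₀ ∀ σ < σ₀`,
for every classical hs-Euler solution on `[0, T)` with the local Gibbs fields as LLN data at time `0`, every
`0 < t < T` with the solution in the chamber `2ρσ³ < η₁` on `[0, t]`, and every admissible kernel family at
mesoscale `(N+1)^{-γ}`, `γ ≤ 1/15`: w.h.p. no block is denser than `η₁/σ³` at any `s ≤ t`
(`DiluteAt σ a₀ θ₀ u₀ Φ t φ η₁`). This file shows that [D] is implied, with `ηbar := 1` and the item's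
`σ₀(η₁)`, by the crux `KineticRangeControl` of route `GermanoSplitLES` (stmt-AtomisticToContinuum-9201: for every
target band `η₀ > 0` and profiles `∃ σ₀ ∀ σ < σ₀`, for every classical solution with `ρσ³ < η₀` on its whole life
`[0, T)`, every flow family with the `t = 0` LLN, every CONTINUOUS kernel family `φ_N ≥ 0`, `∫φ_N = 1`, supported
in `{dist(·,0) ≤ ℓ_N}` with `φ_N ℓ_N³ ≤ A`, `Lip(φ_N) ℓ_N⁴ ≤ A`, `ℓ_N → 0`, `(N+1)ℓ_N³ / log(N+2) → ∞`, and every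
`t < T`: `∃ c, C_ρ, C` with `C_ρ σ³ < η₀` such that w.h.p. the `φ_N(x − ·)`-mollified empirical fields along the
flow stay in the box `{c ≤ ρ̄ ≤ C_ρ, ‖m̄‖ ≤ C, Ē ≤ C, θ̄ ≥ c}` for ALL `s ≤ t`, `x ∈ 𝕋³`).

The glue (`stub_diluteBlocks_of_kineticRangeControl`):
* level: take `η₀ := η₁`; the box ceiling `ρ̄ ≤ C_ρ < η₁/σ³` contains the dilute event `{η₁ < ρ̄σ³}ᶜ`;
* life-long chamber: the stub's chamber `2ρσ³ < η₁` on `[0, t]` extends, by joint continuity of `ρ` on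
  `[0, T) × 𝕋³` and compactness of `𝕋³` (tree tube lemma `IsSmoothSpaceTimeOn.eventually_norm_sub_lt`), to
  `ρσ³ < η₁` on `[0, T')` for some `T' ∈ (t, T]`, and the solution restricts to `[0, T')`
  (`IsHardSphereEulerSolution.restrict`);
* kernels: the item mollifies with `φ_N(x − y)`, the line's blocks with `φ_N(y − x)` (`rhoB`), so the item is fed
  the REFLECTED family `y ↦ φ_N(−y)`, admissible for the item at `ℓ_N := (N+1)^{-γ}` with `A := 2C`: continuity
  from smoothness, unit mass by negation invariance of the Haar measure of `𝕋³`, support by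
  `dist(−y, 0) = dist(y, 0)`, height `φ_N ℓ_N³ ≤ C`, and the Lipschitz bound from `‖∇φ_N‖ ≤ C(N+1)^{4γ}` by the
  torus mean value inequality (`abs_sub_le_of_norm_gradient_le`, `‖x − y‖ ≤ dist`); `ℓ_N → 0` and
  `(N+1)ℓ_N³/log(N+2) = (N+1)^{1−3γ}/log(N+2) → ∞` since `3γ ≤ 1/5`.
-/

namespace Summit.AtomisticToContinuum.HydrodynamicLimit.Theorems.HemisphereAffineSlaving

open scoped BigOperators Topology Classical ENNReal
open Filter Set Function MeasureTheory

noncomputable section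

open Literature.MathematicalPhysics.KineticTheory (T3 V3)
open Literature.Analysis.FluidPDE (Torus.euclidDist Torus.euclidDist_comm Torus.euclidDist_eq)

/-! ## Elementary facts about the mesoscale `ℓ_N = (N+1)^{-γ}` -/

/-- `x^{3γ} · (x^{-γ})³ = 1` for `x > 0`. [folklore] -/
private theorem rpow_three_mul_mul_cube {x : ℝ} (hx : 0 < x) (γ : ℝ) : x ^ (3 * γ) * (x ^ (-γ)) ^ 3 = 1 := by
  have h3 : (x ^ (-γ)) ^ 3 = x ^ (-γ * 3) := by rw [Real.rpow_mul hx.le, Real.rpow_ofNat]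
  rw [h3, ← Real.rpow_add hx, show 3 * γ + -γ * 3 = 0 by ring, Real.rpow_zero]

/-- `x^{4γ} · (x^{-γ})⁴ = 1` for `x > 0`. [folklore] -/
private theorem rpow_four_mul_mul_fourth {x : ℝ} (hx : 0 < x) (γ : ℝ) : x ^ (4 * γ) * (x ^ (-γ)) ^ 4 = 1 := by
  have h4 : (x ^ (-γ)) ^ 4 = x ^ (-γ * 4) := by rw [Real.rpow_mul hx.le, Real.rpow_ofNat]
  rw [h4, ← Real.rpow_add hx, show 4 * γ + -γ * 4 = 0 by ring, Real.rpow_zero]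

/-- `ℓ_N = (N+1)^{-γ} → 0` for `γ > 0`. [folklore] -/
private theorem tendsto_scale {γ : ℝ} (hγ : 0 < γ) :
    Tendsto (fun N : ℕ => ((N : ℝ) + 1) ^ (-γ)) atTop (𝓝 0) :=
  (tendsto_rpow_neg_atTop hγ).comp (tendsto_natCast_atTop_atTop.atTop_add tendsto_const_nhds)

/-- The admissibility rate of the item: `(N+1) ℓ_N³ / log(N+2) = (N+1)^{1-3γ} / log(N+2) → ∞` for
`0 < γ ≤ 1/15` (lower bound `(a/4)(N+1)^{a/2}`, `a = 1 − 3γ`, from `log y ≤ y^ε/ε`). [folklore] -/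
private theorem tendsto_rate {γ : ℝ} (hγ : 0 < γ) (hγ' : γ ≤ 1 / 15) :
    Tendsto (fun N : ℕ => ((N : ℝ) + 1) * (((N : ℝ) + 1) ^ (-γ)) ^ 3 / Real.log ((N : ℝ) + 2)) atTop atTop := by
  set a : ℝ := 1 - 3 * γ with ha
  have ha0 : 0 < a := by rw [ha]; linarith
  set ε : ℝ := a / 2 with hε
  have hε0 : 0 < ε := by positivity
  have hε1 : ε ≤ 1 := by rw [hε, ha]; linarith
  have hae : 0 < a - ε := by rw [hε]; linarith
  have hlow : ∀ N : ℕ, ε / 2 * ((N : ℝ) + 1) ^ (a - ε) ≤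
      ((N : ℝ) + 1) * (((N : ℝ) + 1) ^ (-γ)) ^ 3 / Real.log ((N : ℝ) + 2) := by
    intro N
    have hx : 0 < (N : ℝ) + 1 := by positivity
    have hx2 : 0 < (N : ℝ) + 2 := by positivity
    have hnum : ((N : ℝ) + 1) * (((N : ℝ) + 1) ^ (-γ)) ^ 3 = ((N : ℝ) + 1) ^ a := by
      have h3 : (((N : ℝ) + 1) ^ (-γ)) ^ 3 = ((N : ℝ) + 1) ^ (-γ * 3) := by
        rw [Real.rpow_mul hx.le, Real.rpow_ofNat]
      rw [h3, show a = 1 + -γ * 3 by rw [ha]; ring, Real.rpow_add hx, Real.rpow_one]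
    have hlog_pos : 0 < Real.log ((N : ℝ) + 2) := Real.log_pos (by linarith)
    have hlog : Real.log ((N : ℝ) + 2) ≤ 2 * ((N : ℝ) + 1) ^ ε / ε := by
      have h1 : Real.log ((N : ℝ) + 2) ≤ ((N : ℝ) + 2) ^ ε / ε := Real.log_le_rpow_div hx2.le hε0
      have h2 : ((N : ℝ) + 2) ^ ε ≤ 2 * ((N : ℝ) + 1) ^ ε := by
        calc ((N : ℝ) + 2) ^ ε ≤ (2 * ((N : ℝ) + 1)) ^ ε := Real.rpow_le_rpow hx2.le (by linarith) hε0.le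
          _ = 2 ^ ε * ((N : ℝ) + 1) ^ ε := Real.mul_rpow (by norm_num) hx.le
          _ ≤ (2 : ℝ) ^ (1 : ℝ) * ((N : ℝ) + 1) ^ ε := by
              gcongr
              · norm_num
          _ = 2 * ((N : ℝ) + 1) ^ ε := by rw [Real.rpow_one]
      exact h1.trans (by gcongr)
    rw [hnum, le_div_iff₀ hlog_pos]
    have hxae : 0 ≤ ((N : ℝ) + 1) ^ (a - ε) := (Real.rpow_pos_of_pos hx _).le
    calc ε / 2 * ((N : ℝ) + 1) ^ (a - ε) * Real.log ((N : ℝ) + 2)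
        ≤ ε / 2 * ((N : ℝ) + 1) ^ (a - ε) * (2 * ((N : ℝ) + 1) ^ ε / ε) := by gcongr
      _ = ((N : ℝ) + 1) ^ (a - ε) * ((N : ℝ) + 1) ^ ε := by field_simp
      _ = ((N : ℝ) + 1) ^ a := by rw [← Real.rpow_add hx, sub_add_cancel]
  refine tendsto_atTop_mono hlow ?_
  exact Tendsto.const_mul_atTop (by positivity)
    ((tendsto_rpow_atTop hae).comp (tendsto_natCast_atTop_atTop.atTop_add tendsto_const_nhds))

/-! ## The reflected kernel family `y ↦ φ_N(−y)` is admissible for the item -/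

/-- `dist(−x, 0) = dist(x, 0)` for the minimal-image distance. [folklore] -/
private theorem euclidDist_neg_zero (x : T3) : Torus.euclidDist (-x) 0 = Torus.euclidDist x 0 := by
  rw [Torus.euclidDist_comm x 0, Torus.euclidDist_eq, Torus.euclidDist_eq, sub_zero, zero_sub]

/-- `dist(−x, −y) = dist(x, y)` for the minimal-image distance. [folklore] -/
private theorem euclidDist_neg_neg (x y : T3) : Torus.euclidDist (-x) (-y) = Torus.euclidDist x y := by
  rw [Torus.euclidDist_comm x y, Torus.euclidDist_eq, Torus.euclidDist_eq, neg_sub_neg]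

/-- The item's kernel hypotheses for the reflected family of an admissible kernel family at
`ℓ_N := (N+1)^{-γ}`: continuity, sign, unit mass, support, and the height/Lipschitz constant `A := 2C`. [folklore] -/
private theorem reflected_admissible {γ C : ℝ} {φ : ℕ → T3 → ℝ} (hφ : AdmissibleKernel γ C φ) :
    (∀ N : ℕ, Continuous (fun y : T3 => φ N (-y))) ∧ (∀ (N : ℕ) (x : T3), 0 ≤ φ N (-x)) ∧
    (∀ N : ℕ, ∫ x : T3, φ N (-x) = 1) ∧
    (∀ (N : ℕ) (x : T3), ((N : ℝ) + 1) ^ (-γ) < Torus.euclidDist x 0 → φ N (-x) = 0) ∧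
    (∃ A : ℝ, ∀ (N : ℕ) (x y : T3), φ N (-x) * (((N : ℝ) + 1) ^ (-γ)) ^ 3 ≤ A ∧
      |φ N (-x) - φ N (-y)| * (((N : ℝ) + 1) ^ (-γ)) ^ 4 ≤ A * Torus.euclidDist x y) := by
  obtain ⟨hsm, hnn, hmass, hsupp, hsup, hgrad⟩ := hφ
  -- negation invariance of the Haar probability measure of `𝕋³` (product of circles)
  haveI : (volume : Measure T3).IsNegInvariant := Pi.isNegInvariant_volume
  refine ⟨fun N => (hsm N).continuous.comp continuous_neg, fun N x => hnn N (-x),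
    fun N => (integral_neg_eq_self (φ N) volume).trans (hmass N),
    fun N x hx => hsupp N (-x) (by rw [euclidDist_neg_zero]; exact hx.le), ⟨2 * C, fun N x y => ?_⟩⟩
  have hx : 0 < (N : ℝ) + 1 := by positivity
  have hℓ : 0 < ((N : ℝ) + 1) ^ (-γ) := Real.rpow_pos_of_pos hx _
  -- `C ≥ 0` (a nonnegative kernel is below `C (N+1)^{3γ}`)
  have hC : 0 ≤ C := by
    have h := (hnn N x).trans (hsup N x)
    exact nonneg_of_mul_nonneg_left h (Real.rpow_pos_of_pos hx _)
  constructor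
  · -- height: `φ ℓ³ ≤ C (N+1)^{3γ} ℓ³ = C ≤ 2C`
    calc φ N (-x) * (((N : ℝ) + 1) ^ (-γ)) ^ 3
        ≤ C * ((N : ℝ) + 1) ^ (3 * γ) * (((N : ℝ) + 1) ^ (-γ)) ^ 3 := by
          gcongr
          exact hsup N (-x)
      _ = C := by rw [mul_assoc, rpow_three_mul_mul_cube hx, mul_one]
      _ ≤ 2 * C := by linarith
  · -- Lipschitz: mean value inequality on `𝕋³` with `‖∇φ_N‖ ≤ C (N+1)^{4γ}`, `√3 ≤ 2`, `‖x - y‖ ≤ dist`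
    have hmv := Literature.Analysis.FluidPDE.Torus.abs_sub_le_of_norm_gradient_le (hsm N)
      (fun z => hgrad N z) (-x) (-y)
    have hsqrt : Real.sqrt (Fintype.card (Fin 3) : ℕ) ≤ 2 := by
      rw [Fintype.card_fin, Real.sqrt_le_left (by norm_num)]
      norm_num
    have hL : 0 ≤ C * ((N : ℝ) + 1) ^ (4 * γ) := mul_nonneg hC (Real.rpow_pos_of_pos hx _).le
    have hdist : ‖-x - -y‖ ≤ Torus.euclidDist x y := by
      rw [neg_sub_neg, norm_sub_rev]
      exact Literature.Analysis.FluidPDE.Torus.norm_sub_le_euclidDist_holds x y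
    have hd0 : 0 ≤ Torus.euclidDist x y := by rw [Torus.euclidDist_eq]; exact norm_nonneg _
    calc |φ N (-x) - φ N (-y)| * (((N : ℝ) + 1) ^ (-γ)) ^ 4
        ≤ Real.sqrt (Fintype.card (Fin 3) : ℕ) * (C * ((N : ℝ) + 1) ^ (4 * γ)) * ‖-x - -y‖ *
            (((N : ℝ) + 1) ^ (-γ)) ^ 4 := by gcongr
      _ ≤ 2 * (C * ((N : ℝ) + 1) ^ (4 * γ)) * Torus.euclidDist x y * (((N : ℝ) + 1) ^ (-γ)) ^ 4 := by
          gcongr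
      _ = 2 * C * Torus.euclidDist x y * (((N : ℝ) + 1) ^ (4 * γ) * (((N : ℝ) + 1) ^ (-γ)) ^ 4) := by ring
      _ = 2 * C * Torus.euclidDist x y := by rw [rpow_four_mul_mul_fourth hx, mul_one]

/-! ## Life-long chamber from the chamber on `[0, t]` -/

/-- **Chamber extension.** If a classical hs-Euler solution on `[0, T)` satisfies `2ρσ³ < η₁` on `[0, t] × 𝕋³`,
`0 ≤ t < T`, then `ρσ³ < η₁` on `[0, T') × 𝕋³` for some `T' ∈ (t, T]`: at time `t` there is room `η₁/2`, and
`ρ(s, ·) → ρ(t, ·)` uniformly on `𝕋³` as `s → t` within `[0, T)` (joint continuity + compactness of `𝕋³`,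
`IsSmoothSpaceTimeOn.eventually_norm_sub_lt`). [folklore] -/
private theorem chamber_extend {σ T t η₁ : ℝ} {ρ θ : ℝ → T3 → ℝ} {u : ℝ → T3 → V3}
    (hE : Literature.MathematicalPhysics.KineticTheory.IsHardSphereEulerSolution σ T ρ u θ) (hσ : 0 < σ)
    (ht : 0 ≤ t) (htT : t < T) (hch : ∀ s ∈ Icc 0 t, ∀ x, 2 * ρ s x * σ ^ 3 < η₁) :
    ∃ T' : ℝ, t < T' ∧ T' ≤ T ∧ ∀ s ∈ Ico 0 T', ∀ x, ρ s x * σ ^ 3 < η₁ := by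
  have htI : t ∈ Ico 0 T := ⟨ht, htT⟩
  have hσ3 : 0 < σ ^ 3 := pow_pos hσ 3
  have hη : 0 < η₁ := by
    have h1 := hch t ⟨ht, le_rfl⟩ 0
    have hρ := hE.density_pos t htI 0
    nlinarith
  set ε : ℝ := η₁ / (2 * σ ^ 3) with hε
  have hεpos : 0 < ε := by positivity
  have hev := hE.smooth_density.eventually_norm_sub_lt htI hεpos
  rw [eventually_nhdsWithin_iff, Metric.eventually_nhds_iff] at hev
  obtain ⟨δ, hδ, hev⟩ := hev
  refine ⟨min T (t + δ), lt_min htT (by linarith), min_le_left _ _, fun s hs x => ?_⟩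
  have hsT : s ∈ Ico 0 T := ⟨hs.1, hs.2.trans_le (min_le_left _ _)⟩
  rcases le_or_gt s t with hst | hst
  · have h1 := hch s ⟨hs.1, hst⟩ x
    have hρ := hE.density_pos s hsT x
    nlinarith
  · have hsd : dist s t < δ := by
      rw [Real.dist_eq, abs_of_pos (sub_pos.2 hst)]
      linarith [hs.2.trans_le (min_le_right T (t + δ))]
    have h1 := hev hsd hsT x
    rw [Real.norm_eq_abs] at h1
    have h2 := hch t ⟨ht, le_rfl⟩ x
    have h3 : ρ s x < ρ t x + ε := by linarith [(abs_lt.1 h1).2]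
    calc ρ s x * σ ^ 3 < (ρ t x + ε) * σ ^ 3 := by gcongr
      _ = ρ t x * σ ^ 3 + η₁ / 2 := by rw [hε]; field_simp
      _ < η₁ := by linarith

/-! ## [D] from stmt-9201 -/

/-- **[D] from stmt-9201.** The crux `GermanoSplitLES.KineticRangeControl` (no mesoscopic vacuum / hot / dense
pockets at any admissible kinetic filter before the shock, in local-Gibbs probability, for classical solutions in a
packing band `ρσ³ < η₀`) implies the line's dilute block ceiling [D] `stub_diluteBlocks` verbatim, with `ηbar := 1`
and the item's `σ₀(η₁)`: given the stub's data at level `η₁`, extend the chamber `2ρσ³ < η₁` on `[0, t]` to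
`ρσ³ < η₁` on a life `[0, T')`, `t < T' ≤ T` (`chamber_extend`), restrict the solution to `[0, T')`, feed the item
the reflected kernel family `y ↦ φ_N(−y)` at `ℓ_N = (N+1)^{-γ}` (`reflected_admissible`, `tendsto_scale`,
`tendsto_rate`), and read the dilute event `{∃ s ≤ t, ∃ x, η₁ < ρ̄σ³}` inside the complement of the item's box
event through `ρ̄ ≤ C_ρ`, `C_ρ σ³ < η₁` (`rhoB φ N w x = ∫ φ_N(−(x − y)) dμ_w`). -/
theorem stub_diluteBlocks_of_kineticRangeControl : Summit.AtomisticToContinuum.HydrodynamicLimit.Theses.GermanoSplitLES.KineticRangeControl → ∀ (a₀ θ₀ : T3 → ℝ) (u₀ : T3 → V3), NiceProfiles a₀ θ₀ u₀ → ∃ ηbar : ℝ, 0 < ηbar ∧ ∀ η₁ : ℝ, 0 < η₁ → η₁ ≤ ηbar → ∃ σ₀ : ℝ, 0 < σ₀ ∧ ∀ σ : ℝ, 0 < σ → σ < σ₀ → ∀ (T : ℝ) (ρ θ : ℝ → T3 → ℝ) (u : ℝ → T3 → V3), Literature.MathematicalPhysics.KineticTheory.IsHardSphereEulerSolution σ T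 ρ u θ → ∀ Φ : Flows σ, Literature.MathematicalPhysics.KineticTheory.TendstoHydroFieldsAt (fun N => Literature.MathematicalPhysics.KineticTheory.localGibbsLaw σ a₀ u₀ θ₀ N (Φ N)) Φ ρ u θ 0 → ∀ t : ℝ, 0 < t → t < T → (∀ s ∈ Icc 0 t, ∀ x, 2 * ρ s x * σ ^ 3 < η₁) → ∀ (γ C : ℝ) (φ : ℕ → T3 → ℝ), 0 < γ → γ ≤ 1 / 15 → AdmissibleKernel γ C φ → DiluteAt σ a₀ θ₀ u₀ Φ t φ η₁ := by
  intro hK a₀ θ₀ u₀ hP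
  obtain ⟨ha, hθ, hu, ha0, hθ0⟩ := hP
  refine ⟨1, one_pos, fun η₁ hη₁ _ => ?_⟩
  obtain ⟨σ₀, hσ₀, H⟩ := hK η₁ hη₁ a₀ θ₀ u₀ ha hθ hu ha0 hθ0
  refine ⟨σ₀, hσ₀, fun σ hσ hσlt T ρ θ u hE Φ hL t ht htT hch γ C φ hγ hγ' hφ => ?_⟩
  -- life-long chamber on `[0, T')` and restriction of the solution
  obtain ⟨T', htT', hT'T, hch'⟩ := chamber_extend hE hσ ht.le htT hch
  have hE' := hE.restrict hT'T
  -- the reflected kernel family at `ℓ_N = (N+1)^{-γ}`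
  obtain ⟨h1, h2, h3, h4, h5⟩ := reflected_admissible hφ
  have h6 : ∀ N : ℕ, 0 < ((N : ℝ) + 1) ^ (-γ) := fun N => Real.rpow_pos_of_pos (by positivity) _
  obtain ⟨c, Cρ, C', -, hCρ, -, hT⟩ := H σ hσ hσlt T' ρ θ u hE' hch' Φ hL (fun N y => φ N (-y))
    (fun N => ((N : ℝ) + 1) ^ (-γ)) h1 h2 h3 h4 h5 h6 (tendsto_scale hγ) (tendsto_rate hγ hγ') t ⟨ht.le, htT'⟩
  -- the dilute event sits inside the complement of the box event
  refine tendsto_of_tendsto_of_tendsto_of_le_of_le tendsto_const_nhds hT (fun N => bot_le)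
    (fun N => measure_mono ?_)
  rintro z ⟨s, hs, x, hx⟩
  simp only [Set.mem_setOf_eq]
  refine ⟨s, hs, x, fun hbox => ?_⟩
  have hle : Literature.MathematicalPhysics.KineticTheory.empiricalDensityField ((Φ N).flow s z)
      (fun y => φ N (-(x - y))) ≤ Cρ := hbox.2.1
  have hrho : rhoB φ N ((Φ N).flow s z) x =
      Literature.MathematicalPhysics.KineticTheory.empiricalDensityField ((Φ N).flow s z) (fun y => φ N (-(x - y))) := by
    simp only [rhoB, neg_sub]
  have hσ3 : 0 < σ ^ 3 := pow_pos hσ 3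
  rw [hrho] at hx
  nlinarith
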